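import Summits.QuantumFields.YangMills.Theorems.UnitScaleTiltProp7QTwSScalarSector
import Literature.MathematicalPhysics.QuantumFieldTheory.Balaban1983to89.B7Eq99Concrete
import HarnessLib

/-!
# Route `UnitScaleTilt`, crux K1 child «MinimiserStabilityRegPr» (stmt-QuantumFields-19200), stub `stub_existenceMinimalOrbit` (EX), lane II (B4★)∕(QB) «⊕ central» summand —
# **THE COMB TOWER OF [Balaban1985Averaging] §§B–C IS EQUIVARIANT UNDER CENTRAL RESCALING** (generic `ℤᵈ` part; the `ℤᵈ`∕comb-frame twin of ✓`Prop7EMLTowerCentral`):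
# for a scalar bond field `φ : Site d → Fin d → ℂˣ` read in the centre of `𝔸` (`ι = algebraMap ℂ 𝔸`, `ιˣ = Units.map ι`), the `k`-fold average (43) of `(ιφ)·U₀` FACTORS as
# `ι(φ̄ᵏ)·Ū₀ᵏ`, the twisted towers (69) `Ũ₁ʲ` of the perturbation `U₁ = ιφ` against `U₀` are the plain scalar averages `ι(φ̄ʲ)`, and the recursively defined block frames (85)
# `w_k = \overline{R_{0,·}U₁^{(k)}}` of a CENTRAL perturbation DO NOT SEE THE BACKGROUND: `wrec L U₀ (ιφ) k = ι ∘ wrec L 1 φ k` (= `ι ∘ vprod L φ k`, the flat accumulated frames (160)) —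
# because a central factor passes through every `U₀`-holonomy (9), through the rotations `R(U₀(Γ))` of (56)∕(59), and through `log`∕`exp` of commuting elements on the principal branch
# ((21): `log(ι z·Y) = ι log z + log Y`, `log ι z = ι log z`).

Cell `ym3-torus`, width seat `ym3-torus-px10` (gen 5).  `--supports stmt-QuantumFields-19200 --as helper`; THEOREMS ONLY (0 `def`, 0 `sorry`); count-neutral; nothing here claims the
stub, the crux, d = 4 or the mass gap — YM₃ on T³ is a ladder rung (R3), not the Clay problem.

WHY (px19 g6 LOCATE v2 `LOCATE-v2-ENG-byname-px19g6.md` §3 «(TRACELESS vs ALL A) — THE LOCATED LETTER GAP», exit (c-i); px10 g5 `LOCATE-QBc-CENTRAL-COMB-px10g5.md`).  The lane-II engine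
(ENG)∕(QB) of ✓`Prop7HcoOfDivRecovery.hCo_of_divRecovery` is stated on ALL `M₂(ℂ)`-valued one-forms; its traceless sector is the leg identity ⊕ (R-LEGS) (px19 g6), its CENTRAL sector
`A = τ•1` needs the comb chart `QTw U₀ := fderiv (logChartTw U₀) 0` of ✓`Prop7SymAvgTwDefs` ON `ℂ·1` — whose frames are the comb frames `frameTw U₀ A y = wrec L U₀♯ (e^{A})♯ (K − n) (coordT3 y)`
(lit `B7Eq99Concrete.wrec`).  The tree holds the central calculus for the SYMMETRIC chart (✓`Prop7SymAvgTwSym.logChartTwS_central`, `QTwS_apply_smul_one[_of_regPr]`) and for the TORUS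
`exp[mean log]` tower (✓`Prop7EMLTowerCentral`); this file supplies it for the `ℤᵈ` comb letters, the T³ sibling `…Prop7QTwCentralSector` reads it at `U₀♯ := pull (bgUnits F K U₀) x₀`,
`φ := (e^{iz})♯`.

WHAT IS PROVED (any group `G` for §1; any complete normed ℂ-algebra `𝔸` with `‖1‖ = 1` for §§2–3; `Site d = ℤᵈ` of lit `B7Prop1Explicit`; smallness = «within `1∕8` of `1`», frames «within `1`»):
* §1 (exact, no smallness) `hol_map` (functoriality of (9) under a group hom), `commute_hol_of_central`, `hol_mul_of_central` (`(ψW)(Γ) = ψ(Γ)W(Γ)` for pointwise-central `ψ`),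
  ★`hol_centralMul` (`((ιφ)·W)(Γ) = ι(φ(Γ))·W(Γ)`), `Wcx_centralMul` ((42)'s loop variables factor), `tHol_centralMul_self` ((58): `(R_{0,y}(ιψ))(Γ) = ι(ψ(Γ))` against ANY `V₀` — the
  background transports cancel exactly), `R0fun_central` ((59): `R(V₀(Γ_{y,x}))` fixes central values).
* §2 (principal branch) `Xavg_centralMul`∕★`bavg_centralMul` ((42): `\overline{(ιφ)·W}(c) = ι(φ̄(c))·W̄(c)` when the loop variables `V(Γ_{c,x})V(c)⁻¹` of `W` and of `φ` at `c` are
  `1∕8`-small), `Sexp_central`∕★`savg_central` ((78): `{ι g(x)}_{x∈B(y)} = ι{g(x)}_{x∈B(y)}` when `g(y)⁻¹g(x)` is within `1` of `1` on the block).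
* §3 (towers, by induction on the level with DISPLAYED windows at every level `j < k`) ★★`avgIter_centralMul` ((43): `\overline{(ιφ)·W}ᵏ = ι(φ̄ᵏ)·W̄ᵏ`), ★`tildIter_centralMul_self`
  ((69): `Ũ₁ᵏ = ι(φ̄ᵏ)` for `U₁ = ιφ`), ★★★`wrec_centralMul_self` ((85): `wrec L U₀ (ιφ) k z = ι(wrec L 1 φ k z)`) and `wrec_central_eq_vprod` (`= ι(vprod L φ k z)`, lit `wrec_one_left`).
HONEST SCOPE.  Banach-algebra bookkeeping over lit-balaban's concrete letters; no estimate beyond the displayed windows (which the T³ sibling discharges at a printed-regular background and a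
unitary scalar perturbation from lit `B7Prop2Explicit.prop2_explicit`∕`norm_Wcx_sub_one_le` and `B8Prop7AdmittedFamily` §3); nothing of [Balaban1985Averaging] is asserted.

References: T. Bałaban, CMP **98** (1985) 17–51 [Balaban1985Averaging] ((9) p.19, (21)–(26) p.22, (42)–(43) pp.23–24, (56)–(59) p.27, (65)+(69) p.29, (78)+(82) p.30, (85)+(87) p.31,
(97)+(99) p.32, (160) p.42); CMP **109** (1987) 249–301 [Balaban1987RG1] ((0.4), (0.6) p.253).
-/

set_option autoImplicit false

noncomputable section

namespace Summit.QuantumFields.YangMills.Theorems.Prop7CombTowerCentral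

open NormedSpace
open Literature.MathematicalPhysics.QuantumFieldTheory.Balaban1983to89
open MatrixLog (mlog)
open B7Prop1Explicit (Site Letter e hol hol_nil hol_cons stepHol stepHol_true stepHol_false expUnit val_expUnit boxVec treeWord seg gammaWord Wcx Xavg bavg)
open B7Prop2Explicit (avgIter avgIter_zero avgIter_succ rescale rescale_apply)
open B7Eq92Concrete (Rc Rc_apply tHol tHol_one_left tildIter tildIter_apply tildIter_one_left avgIter_one)
open B7Eq99Concrete (R0fun R0fun_apply R0fun_one_left Sexp savg savg_apply Sexp_apply wrec wrec_zero wrec_succ wrec_one_left)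
open B7Prop6Flat (vprod)
open B8Ineq130 (hol_one)
open Summit.QuantumFields.YangMills.Theorems.Prop7SymAvgTwSym (mlog_algebraMap_mul mlog_algebraMap norm_algebraMap_sub_one commute_unitsMap_algebraMap commute_algebraMap)

variable {d : ℕ}

/-! ## §1 Exact bookkeeping: holonomies, loop variables, twisted transports and rotations of centrally rescaled fields -/

section Exact

variable {G H : Type*} [Group G] [Group H]

/-- **FUNCTORIALITY OF (9)**: a group homomorphism passes through parallel transport, `f(V)(Γ) = f(V(Γ))`. [cite: Balaban1985Averaging, (9) p.19] -/
theorem hol_map (f : G →* H) (V : Site d → Fin d → G) :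
    ∀ (x : Site d) (w : List (Letter d)), hol (fun x κ => f (V x κ)) x w = f (hol V x w)
  | x, [] => by rw [hol_nil, hol_nil, map_one]
  | x, (μ, true) :: w => by rw [hol_cons, hol_cons, stepHol_true, stepHol_true, hol_map f V _ w, map_mul]
  | x, (μ, false) :: w => by rw [hol_cons, hol_cons, stepHol_false, stepHol_false, hol_map f V _ w, map_mul, map_inv]

/-- the transport of a pointwise-central field is central. [cite: Balaban1985Averaging, (9) p.19] -/
theorem commute_hol_of_central (ψ : Site d → Fin d → G) (hψ : ∀ (x : Site d) (κ : Fin d) (g : G), Commute (ψ x κ) g) :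
    ∀ (x : Site d) (w : List (Letter d)) (g : G), Commute (hol ψ x w) g
  | x, [], g => by rw [hol_nil]; exact Commute.one_left g
  | x, (μ, true) :: w, g => by rw [hol_cons, stepHol_true]; exact (hψ x μ g).mul_left (commute_hol_of_central ψ hψ _ w g)
  | x, (μ, false) :: w, g => by rw [hol_cons, stepHol_false]; exact (hψ _ μ g).inv_left.mul_left (commute_hol_of_central ψ hψ _ w g)

/-- **(9) FOR A PRODUCT WITH A POINTWISE-CENTRAL FACTOR**: `(ψW)(Γ) = ψ(Γ)·W(Γ)` — exact. [cite: Balaban1985Averaging, (9) p.19] -/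
theorem hol_mul_of_central (ψ W : Site d → Fin d → G) (hψ : ∀ (x : Site d) (κ : Fin d) (g : G), Commute (ψ x κ) g) :
    ∀ (x : Site d) (w : List (Letter d)), hol (ψ * W) x w = hol ψ x w * hol W x w
  | x, [] => by rw [hol_nil, hol_nil, hol_nil, one_mul]
  | x, (μ, true) :: w => by
    rw [hol_cons, hol_cons, hol_cons, stepHol_true, stepHol_true, stepHol_true, Pi.mul_apply, Pi.mul_apply, hol_mul_of_central ψ W hψ _ w]
    have hc := (commute_hol_of_central ψ hψ (x + Letter.vec (μ, true)) w (W x μ)).eq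
    calc ψ x μ * W x μ * (hol ψ (x + Letter.vec (μ, true)) w * hol W (x + Letter.vec (μ, true)) w)
        = ψ x μ * (W x μ * hol ψ (x + Letter.vec (μ, true)) w) * hol W (x + Letter.vec (μ, true)) w := by simp only [mul_assoc]
      _ = ψ x μ * hol ψ (x + Letter.vec (μ, true)) w * (W x μ * hol W (x + Letter.vec (μ, true)) w) := by rw [← hc]; simp only [mul_assoc]
  | x, (μ, false) :: w => by
    rw [hol_cons, hol_cons, hol_cons, stepHol_false, stepHol_false, stepHol_false, Pi.mul_apply, Pi.mul_apply, hol_mul_of_central ψ W hψ _ w, mul_inv_rev]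
    have hc := (commute_hol_of_central ψ hψ (x + Letter.vec (μ, false)) w (W (x - e μ) μ)⁻¹).eq
    have hc' := ((hψ (x - e μ) μ (W (x - e μ) μ)⁻¹).inv_left).eq
    calc (W (x - e μ) μ)⁻¹ * (ψ (x - e μ) μ)⁻¹ * (hol ψ (x + Letter.vec (μ, false)) w * hol W (x + Letter.vec (μ, false)) w)
        = (ψ (x - e μ) μ)⁻¹ * ((W (x - e μ) μ)⁻¹ * hol ψ (x + Letter.vec (μ, false)) w) * hol W (x + Letter.vec (μ, false)) w := by
          rw [← hc']; simp only [mul_assoc]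
      _ = (ψ (x - e μ) μ)⁻¹ * hol ψ (x + Letter.vec (μ, false)) w * ((W (x - e μ) μ)⁻¹ * hol W (x + Letter.vec (μ, false)) w) := by
          rw [← hc]; simp only [mul_assoc]

/-- **(58) AGAINST ANY BACKGROUND, CENTRAL PERTURBATION**: `(R_{0,y}ψ)(Γ) = (ψV₀)(Γ)·V₀(Γ)⁻¹ = ψ(Γ)` for pointwise-central `ψ` — the background transports CANCEL EXACTLY.
[cite: Balaban1985Averaging, (58) p.27] -/
theorem tHol_of_central (V₀ ψ : Site d → Fin d → G) (hψ : ∀ (x : Site d) (κ : Fin d) (g : G), Commute (ψ x κ) g) (y : Site d) (w : List (Letter d)) :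
    tHol V₀ ψ y w = hol ψ y w := by
  unfold tHol
  rw [hol_mul_of_central ψ V₀ hψ y w, mul_inv_cancel_right]

/-- **(59): the rotation `R(V₀(Γ_{y,x}))` FIXES CENTRAL VALUES** — `(R_{0,y}g)(x) = g(x)` for a pointwise-central site function `g`. [cite: Balaban1985Averaging, p.27 (display after (59))] -/
theorem R0fun_of_central (V₀ : Site d → Fin d → G) (y : Site d) (g : Site d → G) (hg : ∀ (x : Site d) (a : G), Commute (g x) a) :
    R0fun V₀ y g = g := by
  funext x
  rw [R0fun_apply, Rc_apply, ← (hg x (hol V₀ y (treeWord (x - y)))).eq, mul_inv_cancel_right]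

end Exact

section Central

variable {𝔸 : Type*} [NormedRing 𝔸] [NormOneClass 𝔸] [NormedAlgebra ℂ 𝔸] [CompleteSpace 𝔸]

omit [NormOneClass 𝔸] [CompleteSpace 𝔸] in
/-- centrally embedded scalar fields are pointwise central. [folklore] -/
theorem central_unitsMap (φ : Site d → Fin d → ℂˣ) :
    ∀ (x : Site d) (κ : Fin d) (g : 𝔸ˣ), Commute (Units.map ((algebraMap ℂ 𝔸 : ℂ →+* 𝔸) : ℂ →* 𝔸) (φ x κ)) g :=
  fun x κ g => commute_unitsMap_algebraMap (φ x κ) g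

omit [NormOneClass 𝔸] [CompleteSpace 𝔸] in
/-- ★ **HOLONOMIES OF A CENTRALLY RESCALED FIELD ON `ℤᵈ`** ((9)): `((ιφ)·W)(Γ) = ι(φ(Γ))·W(Γ)` — exact. [cite: Balaban1985Averaging, (9) p.19] -/
theorem hol_centralMul (φ : Site d → Fin d → ℂˣ) (W : Site d → Fin d → 𝔸ˣ) (x : Site d) (w : List (Letter d)) :
    hol (fun x κ => Units.map ((algebraMap ℂ 𝔸 : ℂ →+* 𝔸) : ℂ →* 𝔸) (φ x κ) * W x κ) x w =
      Units.map ((algebraMap ℂ 𝔸 : ℂ →+* 𝔸) : ℂ →* 𝔸) (hol φ x w) * hol W x w := by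
  have h := hol_mul_of_central (fun x κ => Units.map ((algebraMap ℂ 𝔸 : ℂ →+* 𝔸) : ℂ →* 𝔸) (φ x κ)) W (central_unitsMap φ) x w
  rw [← hol_map]
  exact h

omit [NormOneClass 𝔸] [CompleteSpace 𝔸] in
/-- the holonomies of the embedded scalar field are the embedded scalar holonomies: `(ιφ)(Γ) = ι(φ(Γ))`. [cite: Balaban1985Averaging, (9) p.19] -/
theorem hol_unitsMap (φ : Site d → Fin d → ℂˣ) (x : Site d) (w : List (Letter d)) :
    hol (fun x κ => Units.map ((algebraMap ℂ 𝔸 : ℂ →+* 𝔸) : ℂ →* 𝔸) (φ x κ)) x w = Units.map ((algebraMap ℂ 𝔸 : ℂ →+* 𝔸) : ℂ →* 𝔸) (hol φ x w) :=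
  hol_map _ φ x w

omit [NormOneClass 𝔸] [CompleteSpace 𝔸] in
/-- **THE LOOP VARIABLES (42) `V(Γ_{c,x})V(c)⁻¹` OF `(ιφ)·W` FACTOR EXACTLY**: `= ι(φ(Γ_{c,x})φ(c)⁻¹)·W(Γ_{c,x})W(c)⁻¹`. [cite: Balaban1985Averaging, (42) p.23] -/
theorem Wcx_centralMul (L : ℕ) (φ : Site d → Fin d → ℂˣ) (W : Site d → Fin d → 𝔸ˣ) (q : Site d) (κ : Fin d) (r : Site d) :
    Wcx L (fun x κ => Units.map ((algebraMap ℂ 𝔸 : ℂ →+* 𝔸) : ℂ →* 𝔸) (φ x κ) * W x κ) q κ r =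
      Units.map ((algebraMap ℂ 𝔸 : ℂ →+* 𝔸) : ℂ →* 𝔸) (Wcx L φ q κ r) * Wcx L W q κ r := by
  unfold Wcx
  rw [hol_centralMul, hol_centralMul, mul_inv_rev, map_mul, map_inv]
  have hc := ((commute_unitsMap_algebraMap (𝔸 := 𝔸) (hol φ q (seg κ L)) (hol W q (gammaWord L κ r) * (hol W q (seg κ L))⁻¹)).inv_left).eq
  calc Units.map (↑(algebraMap ℂ 𝔸)) (hol φ q (gammaWord L κ r)) * hol W q (gammaWord L κ r) * ((hol W q (seg κ L))⁻¹ * (Units.map (↑(algebraMap ℂ 𝔸)) (hol φ q (seg κ L)))⁻¹)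
      = Units.map (↑(algebraMap ℂ 𝔸)) (hol φ q (gammaWord L κ r)) * ((hol W q (gammaWord L κ r) * (hol W q (seg κ L))⁻¹) * (Units.map (↑(algebraMap ℂ 𝔸)) (hol φ q (seg κ L)))⁻¹) := by
        simp only [mul_assoc]
    _ = Units.map (↑(algebraMap ℂ 𝔸)) (hol φ q (gammaWord L κ r)) * (Units.map (↑(algebraMap ℂ 𝔸)) (hol φ q (seg κ L)))⁻¹ * (hol W q (gammaWord L κ r) * (hol W q (seg κ L))⁻¹) := by
        rw [← hc]; simp only [mul_assoc]

omit [NormOneClass 𝔸] [CompleteSpace 𝔸] in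
/-- **(58) FOR A CENTRAL PERTURBATION AGAINST ANY BACKGROUND**: `(R_{0,y}(ιψ))(Γ) = ι(ψ(Γ))` — the twisted tree∕stair transporters of the tower are pure scalars, EXACTLY (the `ℤᵈ` twin of
✓`Prop7SymAvgTwSym.tstairU_centralMul_self`). [cite: Balaban1985Averaging, (58) p.27] -/
theorem tHol_centralMul_self (V₀ : Site d → Fin d → 𝔸ˣ) (ψ : Site d → Fin d → ℂˣ) (y : Site d) (w : List (Letter d)) :
    tHol V₀ (fun x κ => Units.map ((algebraMap ℂ 𝔸 : ℂ →+* 𝔸) : ℂ →* 𝔸) (ψ x κ)) y w = Units.map ((algebraMap ℂ 𝔸 : ℂ →+* 𝔸) : ℂ →* 𝔸) (hol ψ y w) := by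
  rw [tHol_of_central V₀ _ (central_unitsMap ψ), hol_unitsMap]

omit [NormOneClass 𝔸] [CompleteSpace 𝔸] in
/-- **(59): `(R_{0,y}(ι g))(x) = ι g(x)`** — rotations by background transports fix central site functions. [cite: Balaban1985Averaging, p.27 (display after (59))] -/
theorem R0fun_central (V₀ : Site d → Fin d → 𝔸ˣ) (y : Site d) (g : Site d → ℂˣ) :
    R0fun V₀ y (fun x => Units.map ((algebraMap ℂ 𝔸 : ℂ →+* 𝔸) : ℂ →* 𝔸) (g x)) = fun x => Units.map ((algebraMap ℂ 𝔸 : ℂ →+* 𝔸) : ℂ →* 𝔸) (g x) :=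
  R0fun_of_central V₀ y _ fun x a => commute_unitsMap_algebraMap (g x) a


/-! ## §2 Principal branch: the one-step average (42) and the site average (78) of centrally rescaled data -/

omit [NormOneClass 𝔸] [CompleteSpace 𝔸] in
/-- real multiples pass the central embedding: `ι(c • z) = c • ι z`. [folklore] -/
theorem algebraMap_real_smul (c : ℝ) (z : ℂ) : algebraMap ℂ 𝔸 (c • z) = c • algebraMap ℂ 𝔸 z := by
  rw [← Complex.coe_smul, ← Complex.coe_smul, smul_eq_mul, map_mul, Algebra.smul_def]

omit [NormOneClass 𝔸] in
/-- the embedded exponential unit: `ιˣ(e^{a}) = e^{ι a}`. [cite: Balaban1985Averaging, (21) p.22] -/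
theorem unitsMap_expUnit (a : ℂ) : Units.map ((algebraMap ℂ 𝔸 : ℂ →+* 𝔸) : ℂ →* 𝔸) (expUnit a) = expUnit (algebraMap ℂ 𝔸 a) := by
  apply Units.ext
  rw [Units.coe_map, MonoidHom.coe_coe, val_expUnit, val_expUnit, algebraMap_exp_comm]

omit [NormOneClass 𝔸] in
/-- `e^{ι a + b} = ιˣ(e^{a})·e^{b}` (the exponents commute). [cite: Balaban1985Averaging, (21) p.22] -/
theorem expUnit_algebraMap_add (a : ℂ) (b : 𝔸) : expUnit (algebraMap ℂ 𝔸 a + b) = Units.map ((algebraMap ℂ 𝔸 : ℂ →+* 𝔸) : ℂ →* 𝔸) (expUnit a) * expUnit b := by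
  letI : NormedAlgebra ℚ 𝔸 := NormedAlgebra.restrictScalars ℚ ℂ 𝔸
  apply Units.ext
  rw [Units.val_mul, unitsMap_expUnit, val_expUnit, val_expUnit, val_expUnit, exp_add_of_commute (commute_algebraMap a b)]

/-- **THE EXPONENT (42) OF A CENTRALLY RESCALED FIELD SPLITS**: `X_c((ιφ)·W) = ι X_c(φ) + X_c(W)` when the loop variables of `W` and of `φ` at `c` are within `1∕8` of `1` (the logarithms
(21) of the commuting small factors add, ✓`mlog_algebraMap_mul`). [cite: Balaban1985Averaging, (42) p.23, (21) p.22] -/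
theorem Xavg_centralMul (L : ℕ) (φ : Site d → Fin d → ℂˣ) (W : Site d → Fin d → 𝔸ˣ) (q : Site d) (κ : Fin d)
    (hW : ∀ r : Fin d → Fin L, ‖((Wcx L W q κ (boxVec L r) : 𝔸ˣ) : 𝔸) - 1‖ ≤ 1 / 8) (hφ : ∀ r : Fin d → Fin L, ‖((Wcx L φ q κ (boxVec L r) : ℂˣ) : ℂ) - 1‖ ≤ 1 / 8) :
    Xavg L (fun x κ => Units.map ((algebraMap ℂ 𝔸 : ℂ →+* 𝔸) : ℂ →* 𝔸) (φ x κ) * W x κ) q κ = algebraMap ℂ 𝔸 (Xavg L φ q κ) + Xavg L W q κ := by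
  unfold Xavg
  rw [map_sum, ← Finset.sum_add_distrib]
  refine Finset.sum_congr rfl fun r _ => ?_
  rw [Wcx_centralMul, Units.val_mul, Units.coe_map, MonoidHom.coe_coe, mlog_algebraMap_mul (hφ r) (hW r), smul_add, algebraMap_real_smul]

/-- ★ **THE ONE-STEP AVERAGE (42) OF A CENTRALLY RESCALED FIELD FACTORS**: `\overline{(ιφ)·W}(c) = ι(φ̄(c))·W̄(c)` — with `φ̄` the SAME average (42) at `𝔸 = ℂ` — when the loop
variables of `W` and of `φ` at `c` are `1∕8`-small (the `ℤᵈ` twin of ✓`Prop7SymAvgTwSym.emlAvgU_centralMul`). [cite: Balaban1985Averaging, (42) p.23; Balaban1987RG1, (0.6) p.253] -/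
theorem bavg_centralMul (L : ℕ) (φ : Site d → Fin d → ℂˣ) (W : Site d → Fin d → 𝔸ˣ) (q : Site d) (κ : Fin d)
    (hW : ∀ r : Fin d → Fin L, ‖((Wcx L W q κ (boxVec L r) : 𝔸ˣ) : 𝔸) - 1‖ ≤ 1 / 8) (hφ : ∀ r : Fin d → Fin L, ‖((Wcx L φ q κ (boxVec L r) : ℂˣ) : ℂ) - 1‖ ≤ 1 / 8) :
    bavg L (fun x κ => Units.map ((algebraMap ℂ 𝔸 : ℂ →+* 𝔸) : ℂ →* 𝔸) (φ x κ) * W x κ) q κ =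
      Units.map ((algebraMap ℂ 𝔸 : ℂ →+* 𝔸) : ℂ →* 𝔸) (bavg L φ q κ) * bavg L W q κ := by
  unfold bavg
  rw [Xavg_centralMul L φ W q κ hW hφ, expUnit_algebraMap_add, hol_centralMul, map_mul]
  have hc := (commute_unitsMap_algebraMap (𝔸 := 𝔸) (hol φ q (seg κ L)) (expUnit (Xavg L W q κ))).eq
  calc Units.map (↑(algebraMap ℂ 𝔸)) (expUnit (Xavg L φ q κ)) * expUnit (Xavg L W q κ) * (Units.map (↑(algebraMap ℂ 𝔸)) (hol φ q (seg κ L)) * hol W q (seg κ L))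
      = Units.map (↑(algebraMap ℂ 𝔸)) (expUnit (Xavg L φ q κ)) * (expUnit (Xavg L W q κ) * Units.map (↑(algebraMap ℂ 𝔸)) (hol φ q (seg κ L))) * hol W q (seg κ L) := by
        simp only [mul_assoc]
    _ = Units.map (↑(algebraMap ℂ 𝔸)) (expUnit (Xavg L φ q κ)) * Units.map (↑(algebraMap ℂ 𝔸)) (hol φ q (seg κ L)) * (expUnit (Xavg L W q κ) * hol W q (seg κ L)) := by
        rw [← hc]; simp only [mul_assoc]

/-- **THE EXPONENT OF THE SITE AVERAGE (78) OF A CENTRAL SITE FUNCTION**: `S_{ιg}(y) = ι S_g(y)` when `g(y)⁻¹g(x)` is within `1` of `1` on the block (`log ι z = ι log z` on the principal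
branch, ✓`mlog_algebraMap`). [cite: Balaban1985Averaging, (78) p.30, (21) p.22] -/
theorem Sexp_central (L : ℕ) (g : Site d → ℂˣ) (y : Site d) (hg : ∀ r : Fin d → Fin L, ‖((((g y)⁻¹ * g (y + boxVec L r) : ℂˣ)) : ℂ) - 1‖ < 1) :
    Sexp L (fun x => Units.map ((algebraMap ℂ 𝔸 : ℂ →+* 𝔸) : ℂ →* 𝔸) (g x)) y = algebraMap ℂ 𝔸 (Sexp L g y) := by
  rw [Sexp_apply, Sexp_apply, map_sum]
  refine Finset.sum_congr rfl fun r _ => ?_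
  rw [← map_inv, ← map_mul, Units.coe_map, MonoidHom.coe_coe, mlog_algebraMap (hg r), algebraMap_real_smul]

/-- ★ **THE SITE AVERAGE (78) OF A CENTRAL SITE FUNCTION IS CENTRAL**: `{ι g(x)}_{x∈B(y)} = ι({g(x)}_{x∈B(y)})` on the principal branch. [cite: Balaban1985Averaging, (78) p.30] -/
theorem savg_central (L : ℕ) (g : Site d → ℂˣ) (y : Site d) (hg : ∀ r : Fin d → Fin L, ‖((((g y)⁻¹ * g (y + boxVec L r) : ℂˣ)) : ℂ) - 1‖ < 1) :
    savg L (fun x => Units.map ((algebraMap ℂ 𝔸 : ℂ →+* 𝔸) : ℂ →* 𝔸) (g x)) y = Units.map ((algebraMap ℂ 𝔸 : ℂ →+* 𝔸) : ℂ →* 𝔸) (savg L g y) := by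
  rw [savg_apply, savg_apply, Sexp_central L g y hg, ← unitsMap_expUnit, ← map_mul]

/-! ## §3 The towers: (43), (69) and the recursively defined block frames (85) of a centrally rescaled field -/

/-- ★★ **THE `k`-FOLD AVERAGE (43) OF A CENTRALLY RESCALED FIELD FACTORS**: `\overline{(ιφ)·W}ᵏ = ι(φ̄ᵏ)·W̄ᵏ`, PROVIDED at every level `j < k` the loop variables (42) of the iterates
`W̄ʲ` and `φ̄ʲ` are within `1∕8` of `1` — displayed (for a printed-regular background and a small unitary scalar field both follow from [Balaban1985Averaging] Prop. 2, lit
`B7Prop2Explicit.prop2_explicit` + `norm_Wcx_sub_one_le`; the T³ sibling). [cite: Balaban1985Averaging, (43) p.24; Balaban1987RG1, (0.6) p.253] -/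
theorem avgIter_centralMul (L : ℕ) (φ : Site d → Fin d → ℂˣ) (W : Site d → Fin d → 𝔸ˣ) :
    ∀ k : ℕ,
      (∀ j, j < k → ∀ (q : Site d) (κ : Fin d) (r : Fin d → Fin L), ‖((Wcx L (avgIter L W j) q κ (boxVec L r) : 𝔸ˣ) : 𝔸) - 1‖ ≤ 1 / 8) →
      (∀ j, j < k → ∀ (q : Site d) (κ : Fin d) (r : Fin d → Fin L), ‖((Wcx L (avgIter L φ j) q κ (boxVec L r) : ℂˣ) : ℂ) - 1‖ ≤ 1 / 8) →
      avgIter L (fun x κ => Units.map ((algebraMap ℂ 𝔸 : ℂ →+* 𝔸) : ℂ →* 𝔸) (φ x κ) * W x κ) k =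
        fun z κ => Units.map ((algebraMap ℂ 𝔸 : ℂ →+* 𝔸) : ℂ →* 𝔸) (avgIter L φ k z κ) * avgIter L W k z κ
  | 0 => fun _ _ => by funext z κ; rw [avgIter_zero, avgIter_zero, avgIter_zero]
  | k + 1 => fun hW hφ => by
    have ih := avgIter_centralMul L φ W k (fun j hj => hW j (by omega)) (fun j hj => hφ j (by omega))
    funext z κ
    rw [avgIter_succ, rescale_apply, ih, bavg_centralMul L (avgIter L φ k) (avgIter L W k) ((L : ℤ) • z) κ (hW k (by omega) _ κ) (hφ k (by omega) _ κ),
      avgIter_succ, rescale_apply, avgIter_succ, rescale_apply]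

/-- ★ **THE TWISTED TOWER (69) OF A CENTRAL PERTURBATION IS THE SCALAR AVERAGE**: for `U₁ = ιφ`, `Ũ₁ᵏ = \overline{(ιφ)U₀}ᵏ·(Ū₀ᵏ)⁻¹ = ι(φ̄ᵏ)` — no background letter survives
(windows as in `avgIter_centralMul`). [cite: Balaban1985Averaging, (69) p.29, (65) p.29] -/
theorem tildIter_centralMul_self (L : ℕ) (U₀ : Site d → Fin d → 𝔸ˣ) (φ : Site d → Fin d → ℂˣ) (k : ℕ)
    (hU : ∀ j, j < k → ∀ (q : Site d) (κ : Fin d) (r : Fin d → Fin L), ‖((Wcx L (avgIter L U₀ j) q κ (boxVec L r) : 𝔸ˣ) : 𝔸) - 1‖ ≤ 1 / 8)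
    (hφ : ∀ j, j < k → ∀ (q : Site d) (κ : Fin d) (r : Fin d → Fin L), ‖((Wcx L (avgIter L φ j) q κ (boxVec L r) : ℂˣ) : ℂ) - 1‖ ≤ 1 / 8) :
    tildIter L U₀ (fun x κ => Units.map ((algebraMap ℂ 𝔸 : ℂ →+* 𝔸) : ℂ →* 𝔸) (φ x κ)) k =
      fun z κ => Units.map ((algebraMap ℂ 𝔸 : ℂ →+* 𝔸) : ℂ →* 𝔸) (avgIter L φ k z κ) := by
  have hmul : ((fun x κ => Units.map ((algebraMap ℂ 𝔸 : ℂ →+* 𝔸) : ℂ →* 𝔸) (φ x κ)) * U₀ : Site d → Fin d → 𝔸ˣ) =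
      fun x κ => Units.map ((algebraMap ℂ 𝔸 : ℂ →+* 𝔸) : ℂ →* 𝔸) (φ x κ) * U₀ x κ := rfl
  funext z κ
  rw [tildIter_apply, hmul, avgIter_centralMul L φ U₀ k hU hφ, mul_inv_cancel_right]

/-- the flat recursion (85) at `U₀ = 1`, one step: `wrec L 1 φ (k+1) z = {φ̄ᵏ(Γ_{Lz,x})·wrec L 1 φ k (x)}_{x ∈ B(Lz)}` (`1̄ᵏ = 1`, `Ũ₁ᵏ = φ̄ᵏ`, no rotation).
[cite: Balaban1985Averaging, (85) p.31, (160) p.42] -/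
theorem wrec_one_succ (L : ℕ) (φ : Site d → Fin d → ℂˣ) (k : ℕ) (z : Site d) :
    wrec L 1 φ (k + 1) z = savg L (fun x => hol (avgIter L φ k) ((L : ℤ) • z) (treeWord (x - (L : ℤ) • z)) * wrec L 1 φ k x) ((L : ℤ) • z) := by
  rw [wrec_succ, avgIter_one, tildIter_one_left, R0fun_one_left]
  simp only [tHol_one_left]

/-- ★★★ **THE BLOCK FRAMES (85) OF A CENTRAL PERTURBATION DO NOT SEE THE BACKGROUND**: `wrec L U₀ (ιφ) k z = ι(wrec L 1 φ k z)` — for `U₁ = ιφ` the recursively defined averages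
`\overline{R_{0,z}U₁^{(k)}}` against ANY background `U₀` are the FLAT accumulated frames of the scalar field `φ` read in the centre: the twisted transports (58) of `Ũ₁ʲ = ι(φ̄ʲ)` are the
scalar transports `ι(φ̄ʲ(Γ))` exactly, the rotations (59) fix the (central, by induction) previous frames, and the site average (78) of central data is central.  Windows DISPLAYED at every
level `j < k`: the loop variables of `Ū₀ʲ` and of `φ̄ʲ` within `1∕8` of `1`, and the block quotients `w_j(Lz)⁻¹·φ̄ʲ(Γ_{Lz,x})·w_j(x)` of the scalar frames within `1` of `1`.
[cite: Balaban1985Averaging, (85) p.31, (87) p.31, (97)+(99) p.32, (160) p.42] -/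
theorem wrec_centralMul_self (L : ℕ) (U₀ : Site d → Fin d → 𝔸ˣ) (φ : Site d → Fin d → ℂˣ) :
    ∀ k : ℕ,
      (∀ j, j < k → ∀ (q : Site d) (κ : Fin d) (r : Fin d → Fin L), ‖((Wcx L (avgIter L U₀ j) q κ (boxVec L r) : 𝔸ˣ) : 𝔸) - 1‖ ≤ 1 / 8) →
      (∀ j, j < k → ∀ (q : Site d) (κ : Fin d) (r : Fin d → Fin L), ‖((Wcx L (avgIter L φ j) q κ (boxVec L r) : ℂˣ) : ℂ) - 1‖ ≤ 1 / 8) →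
      (∀ j, j < k → ∀ (z : Site d) (r : Fin d → Fin L),
        ‖((((wrec L 1 φ j ((L : ℤ) • z))⁻¹ * (hol (avgIter L φ j) ((L : ℤ) • z) (treeWord (boxVec L r)) * wrec L 1 φ j ((L : ℤ) • z + boxVec L r)) : ℂˣ)) : ℂ) - 1‖ < 1) →
      ∀ z : Site d, wrec L U₀ (fun x κ => Units.map ((algebraMap ℂ 𝔸 : ℂ →+* 𝔸) : ℂ →* 𝔸) (φ x κ)) k z =
        Units.map ((algebraMap ℂ 𝔸 : ℂ →+* 𝔸) : ℂ →* 𝔸) (wrec L 1 φ k z)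
  | 0 => fun _ _ _ z => by rw [wrec_zero, wrec_zero, map_one]
  | k + 1 => fun hU hφ hw z => by
    have ih : wrec L U₀ (fun x κ => Units.map ((algebraMap ℂ 𝔸 : ℂ →+* 𝔸) : ℂ →* 𝔸) (φ x κ)) k =
        fun x => Units.map ((algebraMap ℂ 𝔸 : ℂ →+* 𝔸) : ℂ →* 𝔸) (wrec L 1 φ k x) :=
      funext fun x => wrec_centralMul_self L U₀ φ k (fun j hj => hU j (by omega)) (fun j hj => hφ j (by omega)) (fun j hj => hw j (by omega)) x
    rw [wrec_succ, tildIter_centralMul_self L U₀ φ k (fun j hj => hU j (by omega)) (fun j hj => hφ j (by omega)), ih, R0fun_central]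
    -- the integrand is the embedded scalar integrand
    have hint : (fun x => tHol (avgIter L U₀ k) (fun x κ => Units.map ((algebraMap ℂ 𝔸 : ℂ →+* 𝔸) : ℂ →* 𝔸) (avgIter L φ k x κ)) ((L : ℤ) • z) (treeWord (x - (L : ℤ) • z))
          * Units.map ((algebraMap ℂ 𝔸 : ℂ →+* 𝔸) : ℂ →* 𝔸) (wrec L 1 φ k x))
        = fun x => Units.map ((algebraMap ℂ 𝔸 : ℂ →+* 𝔸) : ℂ →* 𝔸) (hol (avgIter L φ k) ((L : ℤ) • z) (treeWord (x - (L : ℤ) • z)) * wrec L 1 φ k x) := by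
      funext x
      rw [tHol_centralMul_self, map_mul]
    rw [hint, savg_central L _ ((L : ℤ) • z) ?_, wrec_one_succ]
    -- the displayed scalar window at level `k`
    intro r
    have h := hw k (by omega) z r
    rwa [sub_self, B7Prop1Explicit.treeWord_zero, hol_nil, one_mul, add_sub_cancel_left]

/-- **COROLLARY: `wrec L U₀ (ιφ) k z = ι(vprod L φ k z)`** — the flat accumulated frames (160) of lit `B7Prop6Flat` (`B7Eq99Concrete.wrec_one_left`). [cite: Balaban1985Averaging, (160) p.42, (99) p.32] -/
theorem wrec_central_eq_vprod (L : ℕ) (U₀ : Site d → Fin d → 𝔸ˣ) (φ : Site d → Fin d → ℂˣ) (k : ℕ)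
    (hU : ∀ j, j < k → ∀ (q : Site d) (κ : Fin d) (r : Fin d → Fin L), ‖((Wcx L (avgIter L U₀ j) q κ (boxVec L r) : 𝔸ˣ) : 𝔸) - 1‖ ≤ 1 / 8)
    (hφ : ∀ j, j < k → ∀ (q : Site d) (κ : Fin d) (r : Fin d → Fin L), ‖((Wcx L (avgIter L φ j) q κ (boxVec L r) : ℂˣ) : ℂ) - 1‖ ≤ 1 / 8)
    (hw : ∀ j, j < k → ∀ (z : Site d) (r : Fin d → Fin L),
      ‖((((wrec L 1 φ j ((L : ℤ) • z))⁻¹ * (hol (avgIter L φ j) ((L : ℤ) • z) (treeWord (boxVec L r)) * wrec L 1 φ j ((L : ℤ) • z + boxVec L r)) : ℂˣ)) : ℂ) - 1‖ < 1)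
    (z : Site d) :
    wrec L U₀ (fun x κ => Units.map ((algebraMap ℂ 𝔸 : ℂ →+* 𝔸) : ℂ →* 𝔸) (φ x κ)) k z = Units.map ((algebraMap ℂ 𝔸 : ℂ →+* 𝔸) : ℂ →* 𝔸) (vprod L φ k z) := by
  rw [wrec_centralMul_self L U₀ φ k hU hφ hw z, wrec_one_left]

/-- **IN PARTICULAR THE FRAMES ARE BACKGROUND-INDEPENDENT**: `wrec L U₀ (ιφ) k = wrec L 1 (ιφ) k` (both equal `ι ∘ wrec L 1 φ k`; the loop variables of `1̄ʲ = 1` vanish).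
[cite: Balaban1985Averaging, (85) p.31, (160) p.42] -/
theorem wrec_central_eq_wrec_one (L : ℕ) (U₀ : Site d → Fin d → 𝔸ˣ) (φ : Site d → Fin d → ℂˣ) (k : ℕ)
    (hU : ∀ j, j < k → ∀ (q : Site d) (κ : Fin d) (r : Fin d → Fin L), ‖((Wcx L (avgIter L U₀ j) q κ (boxVec L r) : 𝔸ˣ) : 𝔸) - 1‖ ≤ 1 / 8)
    (hφ : ∀ j, j < k → ∀ (q : Site d) (κ : Fin d) (r : Fin d → Fin L), ‖((Wcx L (avgIter L φ j) q κ (boxVec L r) : ℂˣ) : ℂ) - 1‖ ≤ 1 / 8)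
    (hw : ∀ j, j < k → ∀ (z : Site d) (r : Fin d → Fin L),
      ‖((((wrec L 1 φ j ((L : ℤ) • z))⁻¹ * (hol (avgIter L φ j) ((L : ℤ) • z) (treeWord (boxVec L r)) * wrec L 1 φ j ((L : ℤ) • z + boxVec L r)) : ℂˣ)) : ℂ) - 1‖ < 1)
    (z : Site d) :
    wrec L U₀ (fun x κ => Units.map ((algebraMap ℂ 𝔸 : ℂ →+* 𝔸) : ℂ →* 𝔸) (φ x κ)) k z =
      wrec L (1 : Site d → Fin d → 𝔸ˣ) (fun x κ => Units.map ((algebraMap ℂ 𝔸 : ℂ →+* 𝔸) : ℂ →* 𝔸) (φ x κ)) k z := by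
  have h1 : ∀ j, j < k → ∀ (q : Site d) (κ : Fin d) (r : Fin d → Fin L), ‖((Wcx L (avgIter L (1 : Site d → Fin d → 𝔸ˣ) j) q κ (boxVec L r) : 𝔸ˣ) : 𝔸) - 1‖ ≤ 1 / 8 := by
    intro j _ q κ r
    rw [avgIter_one, B8Ineq130.Wcx_one, Units.val_one, sub_self, norm_zero]
    norm_num
  rw [wrec_centralMul_self L U₀ φ k hU hφ hw z, wrec_centralMul_self L 1 φ k h1 hφ hw z]

end Central

end Summit.QuantumFields.YangMills.Theorems.Prop7CombTowerCentral

end
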